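import Literature.NumberTheory.Transcendental.UnivExtTheta
import Literature.NumberTheory.EllipticCurves.ComplexTorusAddProofs
import HarnessLib

/-!
# The chord addition law of the Weierstrass cubic in theta coordinates, with its `ζ`-companion

Topic: `Literature/NumberTheory/Transcendental`. A brick of the programme towards the named fact
`Literature.NumberTheory.Transcendental.philippon1986_std` (Philippon's zero estimate, Bull. SMF
114 (1986), Thm. 2.1, for the groups `M_κ = 𝔾ₘ^β × P_κ` in the theta embedding of
`PkappaTheta.lean`). Every known proof of a zero estimate on a commutative algebraic group `G ⊆ ℙ^N`
(Masser–Wüstholz 1981, §2; Philippon 1986; D. Roy in Nesterenko–Philippon (eds.), LNM 1752,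
Ch. 11, §2.1 and Prop. 3.6 (iv)) uses the **addition laws** of `G`: families of bihomogeneous
polynomials `A(X, Y)` with `[x] + [y] = [A(x, y)]` on a Zariski open set, of degree `≤ c = c(G)` in
`X` — this is what keeps translates and all their derivatives inside degree `c·D`. The theta
functions of `P_κ` are built from the `E`-blocks `P = (P₀, P₁, P₂) = σ³(1, ℘, ℘′)` and their
`ζ`-companions `Z = (Z₀, Z₁, Z₂) = σ³(ζ, ℘ζ, ℘′ζ + 2℘²)` of `UnivExtTheta.lean`; this file PROVES
their addition law, as identities of ENTIRE functions of `(z, t) ∈ ℂ²` (no exceptional set):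

* `PeriodPair.chordA_univExtP` — **the chord law of the cubic**:
  `A_i(P(z), P(t)) = -σ(z - t)³ · P_i(z + t)` (`i = 0, 1, 2`), where
  `A_i(x, y) = ∑_{j,k} α^{(i)}_{jk}(y) x_j x_k` (`PeriodPair.chordA`, coefficient forms
  `PeriodPair.chordCoeff`, symmetric in `j, k`, quadratic in `y`) is bihomogeneous of bidegree
  `(2, 2)` and antisymmetric (`chordA_swap`). Dehomogenised (`x = (1, p, p′)`, `y = (1, q, q′)` on
  `p′² = 4p³ - g₂p - g₃`): `A₀ = (p - q)³`, `A₁ = (p - q)³ ℘(z+t)`, `A₂ = (p - q)³ ℘′(z+t)` with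
  `℘(z+t) = ¼((p′-q′)/(p-q))² - p - q` and `℘′(z+t) = -(p′ + ((p′-q′)/(p-q))(℘(z+t) - p))`
  (`chordA_zero/one/two_affine`, `chordA_affine`) — the chord of the group law (Silverman,
  III.2.3) made bihomogeneous with the cubic relation, i.e. the basic addition law of bidegree
  `(2, 2)` on a Weierstrass cubic (Lange–Ruppert). Its unit `-σ(z - t)³` vanishes exactly on the
  diagonal `z ≡ t (mod Λ)` (`sigma_sub_pow_ne_zero_iff`, `chordA_univExtP_of_sub_mem`) and NOT
  over the origin `z ∈ Λ` of `E`.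
* `PeriodPair.chord_companion` — **the law for the `ζ`-companions**:
  `B_i(P(t); Z(z), P(z)) - B_i(P(z); Z(t), P(t)) + C_i(P(z), P(t)) = -σ(z - t)³ · Z_i(z + t)`,
  with the polarisation `B_i(y; v, x) = ∑ α^{(i)}_{jk}(y) v_j x_k` (`PeriodPair.chordB`) and an
  explicit antisymmetric correction `C_i` of bidegree `(2, 2)` in the blocks alone
  (`PeriodPair.chordC`): translates of companions are linear in the companions of either argument.
  This is the addition law of the compactified universal vectorial extension `Ē♮ ⊂ ℙ⁵` in the
  linear system `|3F₀ + D_∞|`, with the SAME unit as the cubic; packaged for the six theta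
  functions `Θ` of `E♮` in `chordA_univExtTheta`, `chord_univExtTheta_inr`.

Proof. Off the exceptional set (`z, t, z ± t ∉ Λ`) the identities are the addition theorems of
the tree — `℘(z) - ℘(t) = -σ(z-t)σ(z+t)/(σ(z)²σ(t)²)` (`PeriodPair.weierstrassP_sub_eq_sigma_holds`,
cubed: `-σ(z-t)³σ(z+t)³ = (℘(z)-℘(t))³σ(z)⁶σ(t)⁶`), `PeriodPair.weierstrassP_add_holds`,
`PeriodPair.derivWeierstrassP_add_of_ne`, `PeriodPair.weierstrassZeta_add_holds`
(`ζ(z+t) = ζ(z) + ζ(t) + ½(p′-q′)/(p-q)`) — followed by polynomial identities modulo the two cubic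
relations (explicit `linear_combination` certificates: `chordA_*_affine`, `chord_companion_poly`,
`chord_companion_affine`); both sides being entire in each variable, the identities extend to all
`(z, t)` by density (`dense_generic`, `Continuous.ext_on`) and the antisymmetry of both sides.

What this is for (sequel): with the torus factor (`e^{y+u} = e^y e^u`, degree `1`) and Segre
products over the blocks, these laws give bihomogeneous addition laws of bidegree `(2, 2)` for the
theta embedding of `M_κ` with unit `∏_b (-σ(z_b - t_b)³)`, good off the block diagonals; composing
two of them through a generic intermediate point gives laws good at any prescribed pair of points
(degree `4`), hence the translation structure needed by Roy's Prop. 3.6 (iv) on `M_κ`.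

## References

* H. Lange, W. Ruppert, *Complete systems of addition laws on abelian varieties*, Invent. Math.
  79 (1985), 603–610 (addition laws of bidegree `(2, 2)`; the elliptic curve in Weierstraß form,
  where the basic law is defined exactly off the diagonal). [LangeRuppert1985]
* D. W. Masser, G. Wüstholz, *Zero estimates on group varieties I*, Invent. Math. 64 (1981),
  489–516, §2 (addition laws and their associated open sets). [MasserWustholz1981]
* Yu. V. Nesterenko, P. Philippon (eds.), *Introduction to Algebraic Independence Theory*,
  LNM 1752, Springer 2001, Ch. 11 (D. Roy), §2.1 (complete systems of addition laws, `c(G)`),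
  Prop. 3.6 (iv). [NesterenkoPhilippon2001]
* J. H. Silverman, *The Arithmetic of Elliptic Curves*, 2nd ed., GTM 106, III.2.3 (group law
  algorithm: the chord). [SilvermanAEC2009]
* J. V. Armitage, W. F. Eberlein, *Elliptic Functions*, LMS Student Texts 67, §7.4 (addition
  theorems for `℘`, `ζ`, `σ`). [ArmitageEberlein2001]
-/

noncomputable section

open Complex
open scoped PeriodPair

namespace Literature.NumberTheory.Transcendental

variable (L : PeriodPair)

/-! ### The coefficient forms, the law `A` and the correction `C` -/

/-- **Coefficient forms of the chord law.** For `i, j, k ∈ {0,1,2}` a quadratic form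
`α^{(i)}_{jk}(y)` in `y = (y₀, y₁, y₂)`, symmetric in `(j, k)`, such that
`A_i(x, y) = ∑_{j,k} α^{(i)}_{jk}(y) x_j x_k` is the bihomogeneous chord addition law of bidegree
`(2, 2)` on the Weierstrass cubic `x₀x₂² = 4x₁³ - g₂x₀²x₁ - g₃x₀³` (`PeriodPair.chordA`). Deliberate
dot-notation extension of Mathlib's `PeriodPair` (the forms depend on `g₂(Λ), g₃(Λ)`). [folklore] -/
def _root_.PeriodPair.chordCoeff (i j k : Fin 3) (y : Fin 3 → ℂ) : ℂ :=
  ![-- `i = 0`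
    ![![-(y 2) ^ 2 / 4 - L.g₂ / 4 * y 0 * y 1, L.g₂ / 8 * y 0 ^ 2 + 3 / 2 * y 1 ^ 2, 0],
      ![L.g₂ / 8 * y 0 ^ 2 + 3 / 2 * y 1 ^ 2, -3 * y 0 * y 1, 0],
      ![0, 0, y 0 ^ 2 / 4]],
    -- `i = 1`
    ![![L.g₂ / 4 * y 1 ^ 2 + 3 / 4 * L.g₃ * y 0 * y 1, -(y 2) ^ 2 / 8 - 3 / 8 * L.g₃ * y 0 ^ 2,
        y 1 * y 2 / 4],
      ![-(y 2) ^ 2 / 8 - 3 / 8 * L.g₃ * y 0 ^ 2, -(L.g₂ / 4 * y 0 ^ 2), -(y 0 * y 2 / 4)],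
      ![y 1 * y 2 / 4, -(y 0 * y 2 / 4), y 0 * y 1 / 4]],
    -- `i = 2`
    ![![-(L.g₂ / 4 * y 1 * y 2) - 3 / 4 * L.g₃ * y 0 * y 2, -(L.g₂ / 4 * y 0 * y 2),
        -(y 2) ^ 2 / 8 + L.g₂ / 4 * y 0 * y 1 + 3 / 8 * L.g₃ * y 0 ^ 2],
      ![-(L.g₂ / 4 * y 0 * y 2), 3 * y 1 * y 2, -(3 / 2 * y 1 ^ 2) + L.g₂ / 8 * y 0 ^ 2],
      ![-(y 2) ^ 2 / 8 + L.g₂ / 4 * y 0 * y 1 + 3 / 8 * L.g₃ * y 0 ^ 2,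
        -(3 / 2 * y 1 ^ 2) + L.g₂ / 8 * y 0 ^ 2, y 0 * y 2 / 4]]] i j k

/-- **The chord addition law** `A_i(x, y) = ∑_{j,k} α^{(i)}_{jk}(y) x_j x_k` (`i = 0, 1, 2`),
bihomogeneous of bidegree `(2, 2)`. Dot-notation extension of Mathlib's `PeriodPair`. [folklore] -/
def _root_.PeriodPair.chordA (i : Fin 3) (x y : Fin 3 → ℂ) : ℂ :=
  ∑ j : Fin 3, ∑ k : Fin 3, L.chordCoeff i j k y * (x j * x k)

/-- **The correction forms of the `ζ`-companion law** `C_i(x, y)` (`i = 0, 1, 2`), bihomogeneous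
of bidegree `(2, 2)` and antisymmetric. Dot-notation extension of Mathlib's `PeriodPair`. [folklore] -/
def _root_.PeriodPair.chordC (i : Fin 3) (x y : Fin 3 → ℂ) : ℂ :=
  ![-(x 1 ^ 2 * y 0 * y 2 / 2) - x 1 * x 2 * y 0 * y 1 + x 0 * x 1 * y 1 * y 2 +
      x 0 * x 2 * y 1 ^ 2 / 2,
    -(x 2 ^ 2 * y 0 * y 2 / 8) + x 0 * x 2 * y 2 ^ 2 / 8 + L.g₂ / 4 * x 0 * x 1 * y 0 * y 2 -
      L.g₂ / 4 * x 0 * x 2 * y 0 * y 1 + 3 / 8 * L.g₃ * x 0 ^ 2 * y 0 * y 2 -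
      3 / 8 * L.g₃ * x 0 * x 2 * y 0 ^ 2 - x 1 ^ 2 * y 1 * y 2 + x 1 * x 2 * y 1 ^ 2 -
      L.g₂ / 8 * x 1 * x 2 * y 0 ^ 2 + L.g₂ / 8 * x 0 ^ 2 * y 1 * y 2,
    -(x 2 ^ 2 * y 1 ^ 2 / 2) + x 1 ^ 2 * y 2 ^ 2 / 2 + 3 / 4 * L.g₂ * x 0 * x 1 * y 1 ^ 2 -
      3 / 4 * L.g₂ * x 1 ^ 2 * y 0 * y 1 + L.g₂ / 16 * x 2 ^ 2 * y 0 ^ 2 -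
      L.g₂ / 16 * x 0 ^ 2 * y 2 ^ 2 + L.g₂ ^ 2 / 16 * x 0 * x 1 * y 0 ^ 2 -
      L.g₂ ^ 2 / 16 * x 0 ^ 2 * y 0 * y 1] i

/-! ### Elementary properties: symmetry, antisymmetry, bihomogeneity -/

/-- The coefficient forms are symmetric in `(j, k)`. [folklore] -/
theorem _root_.PeriodPair.chordCoeff_symm (i j k : Fin 3) (y : Fin 3 → ℂ) :
    L.chordCoeff i j k y = L.chordCoeff i k j y := by
  fin_cases i <;> fin_cases j <;> fin_cases k <;> simp [PeriodPair.chordCoeff]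

/-- The coefficient forms are quadratic in `y`. [folklore] -/
theorem _root_.PeriodPair.chordCoeff_smul (i j k : Fin 3) (c : ℂ) (y : Fin 3 → ℂ) :
    L.chordCoeff i j k (c • y) = c ^ 2 * L.chordCoeff i j k y := by
  fin_cases i <;> fin_cases j <;> fin_cases k <;> simp [PeriodPair.chordCoeff] <;> ring

/-- `A_i` explicitly (expansion of the double sum). [folklore] -/
theorem _root_.PeriodPair.chordA_eq (i : Fin 3) (x y : Fin 3 → ℂ) :
    L.chordA i x y = L.chordCoeff i 0 0 y * x 0 ^ 2 + L.chordCoeff i 1 1 y * x 1 ^ 2 +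
      L.chordCoeff i 2 2 y * x 2 ^ 2 + 2 * L.chordCoeff i 0 1 y * (x 0 * x 1) +
      2 * L.chordCoeff i 0 2 y * (x 0 * x 2) + 2 * L.chordCoeff i 1 2 y * (x 1 * x 2) := by
  simp only [PeriodPair.chordA, Fin.sum_univ_three, L.chordCoeff_symm i 1 0,
    L.chordCoeff_symm i 2 0, L.chordCoeff_symm i 2 1]
  ring

/-- `A_i` is quadratic in `x`. [folklore] -/
theorem _root_.PeriodPair.chordA_smul_left (i : Fin 3) (c : ℂ) (x y : Fin 3 → ℂ) :
    L.chordA i (c • x) y = c ^ 2 * L.chordA i x y := by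
  simp only [PeriodPair.chordA, Pi.smul_apply, smul_eq_mul, Finset.mul_sum]
  refine Finset.sum_congr rfl fun j _ => Finset.sum_congr rfl fun k _ => ?_
  ring

/-- `A_i` is quadratic in `y`. [folklore] -/
theorem _root_.PeriodPair.chordA_smul_right (i : Fin 3) (c : ℂ) (x y : Fin 3 → ℂ) :
    L.chordA i x (c • y) = c ^ 2 * L.chordA i x y := by
  simp only [PeriodPair.chordA, L.chordCoeff_smul, Finset.mul_sum]
  refine Finset.sum_congr rfl fun j _ => Finset.sum_congr rfl fun k _ => ?_
  ring

/-- **Antisymmetry of the chord law**: `A_i(y, x) = -A_i(x, y)` (as polynomials). [folklore] -/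
theorem _root_.PeriodPair.chordA_swap (i : Fin 3) (x y : Fin 3 → ℂ) :
    L.chordA i y x = -L.chordA i x y := by
  rw [L.chordA_eq, L.chordA_eq]
  fin_cases i <;> simp [PeriodPair.chordCoeff] <;> ring

/-- `C_i` is quadratic in `x`. [folklore] -/
theorem _root_.PeriodPair.chordC_smul_left (i : Fin 3) (c : ℂ) (x y : Fin 3 → ℂ) :
    L.chordC i (c • x) y = c ^ 2 * L.chordC i x y := by
  fin_cases i <;> simp [PeriodPair.chordC] <;> ring

/-- `C_i` is quadratic in `y`. [folklore] -/
theorem _root_.PeriodPair.chordC_smul_right (i : Fin 3) (c : ℂ) (x y : Fin 3 → ℂ) :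
    L.chordC i x (c • y) = c ^ 2 * L.chordC i x y := by
  fin_cases i <;> simp [PeriodPair.chordC] <;> ring

/-- **Antisymmetry of the correction forms**: `C_i(y, x) = -C_i(x, y)`. [folklore] -/
theorem _root_.PeriodPair.chordC_swap (i : Fin 3) (x y : Fin 3 → ℂ) :
    L.chordC i y x = -L.chordC i x y := by
  fin_cases i <;> simp [PeriodPair.chordC] <;> ring

/-! ### The polarised law `B` (companion vector in the first slot) -/

/-- **Polarisation of the chord law**: `B_i(y; v, x) = ∑_{j,k} α^{(i)}_{jk}(y) v_j x_k`, so that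
`A_i(x, y) = B_i(y; x, x)`; the `ζ`-companion law puts the companion vector `Z` in the slot `v`.
Dot-notation extension of Mathlib's `PeriodPair`. [folklore] -/
def _root_.PeriodPair.chordB (i : Fin 3) (y v x : Fin 3 → ℂ) : ℂ :=
  ∑ j : Fin 3, ∑ k : Fin 3, L.chordCoeff i j k y * (v j * x k)

/-- `B_i(y; x, x) = A_i(x, y)`. [folklore] -/
@[simp] theorem _root_.PeriodPair.chordB_self (i : Fin 3) (y x : Fin 3 → ℂ) :
    L.chordB i y x x = L.chordA i x y := rfl

/-- `B_i` is additive in the middle slot. [folklore] -/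
theorem _root_.PeriodPair.chordB_add (i : Fin 3) (y v w x : Fin 3 → ℂ) :
    L.chordB i y (v + w) x = L.chordB i y v x + L.chordB i y w x := by
  simp only [PeriodPair.chordB, Pi.add_apply, ← Finset.sum_add_distrib]
  refine Finset.sum_congr rfl fun j _ => Finset.sum_congr rfl fun k _ => ?_
  ring

/-- `B_i` is linear in the middle slot. [folklore] -/
theorem _root_.PeriodPair.chordB_smul_mid (i : Fin 3) (c : ℂ) (y v x : Fin 3 → ℂ) :
    L.chordB i y (c • v) x = c * L.chordB i y v x := by
  simp only [PeriodPair.chordB, Pi.smul_apply, smul_eq_mul, Finset.mul_sum]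
  refine Finset.sum_congr rfl fun j _ => Finset.sum_congr rfl fun k _ => ?_
  ring

/-- `B_i` is linear in the last slot. [folklore] -/
theorem _root_.PeriodPair.chordB_smul_right (i : Fin 3) (c : ℂ) (y v x : Fin 3 → ℂ) :
    L.chordB i y v (c • x) = c * L.chordB i y v x := by
  simp only [PeriodPair.chordB, Pi.smul_apply, smul_eq_mul, Finset.mul_sum]
  refine Finset.sum_congr rfl fun j _ => Finset.sum_congr rfl fun k _ => ?_
  ring

/-- `B_i` is quadratic in the first slot. [folklore] -/
theorem _root_.PeriodPair.chordB_smul_left (i : Fin 3) (c : ℂ) (y v x : Fin 3 → ℂ) :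
    L.chordB i (c • y) v x = c ^ 2 * L.chordB i y v x := by
  simp only [PeriodPair.chordB, L.chordCoeff_smul, Finset.mul_sum]
  refine Finset.sum_congr rfl fun j _ => Finset.sum_congr rfl fun k _ => ?_
  ring

/-- `B_i` explicitly (expansion of the double sum, using the symmetry of `α`). [folklore] -/
theorem _root_.PeriodPair.chordB_eq (i : Fin 3) (y v x : Fin 3 → ℂ) :
    L.chordB i y v x = L.chordCoeff i 0 0 y * (v 0 * x 0) + L.chordCoeff i 1 1 y * (v 1 * x 1) +
      L.chordCoeff i 2 2 y * (v 2 * x 2) + L.chordCoeff i 0 1 y * (v 0 * x 1 + v 1 * x 0) +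
      L.chordCoeff i 0 2 y * (v 0 * x 2 + v 2 * x 0) +
      L.chordCoeff i 1 2 y * (v 1 * x 2 + v 2 * x 1) := by
  simp only [PeriodPair.chordB, Fin.sum_univ_three, L.chordCoeff_symm i 1 0,
    L.chordCoeff_symm i 2 0, L.chordCoeff_symm i 2 1]
  ring

/-! ### The algebraic identities behind the law

Affine coordinates `x = (1, p, p′)`, `y = (1, q, q′)` on the cubic `p′² = 4p³ - g₂p - g₃`; the
chord through the two points has slope `(p′ - q′)/(p - q)`, and the addition theorems give
`℘(z+t) = ¼((p′-q′)/(p-q))² - p - q`, `℘′(z+t) = -(p′ + ((p′-q′)/(p-q))(℘(z+t) - p))`,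
`ζ(z+t) = ζ(z) + ζ(t) + ½(p′-q′)/(p-q)`. The identities below are polynomial consequences of the
two cubic relations (certificates found by Gröbner reduction, checked by `linear_combination`). -/

section Algebra

variable {L}
variable {p p' q q' : ℂ}

/-- `A₀((1,p,p′),(1,q,q′)) = (p - q)³` on the cubic. [folklore] -/
theorem _root_.PeriodPair.chordA_zero_affine (hp : p' ^ 2 = 4 * p ^ 3 - L.g₂ * p - L.g₃)
    (hq : q' ^ 2 = 4 * q ^ 3 - L.g₂ * q - L.g₃) :
    L.chordA 0 ![1, p, p'] ![1, q, q'] = (p - q) ^ 3 := by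
  rw [L.chordA_eq]
  simp [PeriodPair.chordCoeff]
  linear_combination (1 / 4 : ℂ) * hp - (1 / 4 : ℂ) * hq

/-- `A₁((1,p,p′),(1,q,q′)) = ¼(p-q)(p′-q′)² - (p+q)(p-q)³` on the cubic (`= (p-q)³ ℘(z+t)`).
[folklore] -/
theorem _root_.PeriodPair.chordA_one_affine (hp : p' ^ 2 = 4 * p ^ 3 - L.g₂ * p - L.g₃)
    (hq : q' ^ 2 = 4 * q ^ 3 - L.g₂ * q - L.g₃) :
    L.chordA 1 ![1, p, p'] ![1, q, q'] = (p - q) * (p' - q') ^ 2 / 4 - (p + q) * (p - q) ^ 3 := by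
  rw [L.chordA_eq]
  simp [PeriodPair.chordCoeff]
  linear_combination (q / 2 - p / 4) * hp + (q / 4 - p / 2) * hq

/-- `A₂((1,p,p′),(1,q,q′)) = -p′(p-q)³ - ¼(p′-q′)³ + (2p+q)(p′-q′)(p-q)²` on the cubic
(`= (p-q)³ ℘′(z+t)`). [folklore] -/
theorem _root_.PeriodPair.chordA_two_affine (hp : p' ^ 2 = 4 * p ^ 3 - L.g₂ * p - L.g₃)
    (hq : q' ^ 2 = 4 * q ^ 3 - L.g₂ * q - L.g₃) :
    L.chordA 2 ![1, p, p'] ![1, q, q'] =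
      -(p' * (p - q) ^ 3) - (p' - q') ^ 3 / 4 + (2 * p + q) * (p' - q') * (p - q) ^ 2 := by
  rw [L.chordA_eq]
  simp [PeriodPair.chordCoeff]
  linear_combination (p' / 4 - q' / 2) * hp + (p' / 2 - q' / 4) * hq

/-- The chord values: with `W₁ = ℘(z+t)`, `W₂ = ℘′(z+t)` given by the addition theorems,
`(p-q)³ · (1, W₁, W₂) = (A₀, A₁, A₂)((1,p,p′),(1,q,q′))`. [folklore] -/
theorem _root_.PeriodPair.chordA_affine (i : Fin 3) (hp : p' ^ 2 = 4 * p ^ 3 - L.g₂ * p - L.g₃)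
    (hq : q' ^ 2 = 4 * q ^ 3 - L.g₂ * q - L.g₃) (hne : p ≠ q) {W₁ W₂ : ℂ}
    (hW₁ : W₁ = ((p' - q') / (p - q)) ^ 2 / 4 - p - q)
    (hW₂ : W₂ = -(p' + (p' - q') / (p - q) * (W₁ - p))) :
    (p - q) ^ 3 * ![1, W₁, W₂] i = L.chordA i ![1, p, p'] ![1, q, q'] := by
  have hD : p - q ≠ 0 := sub_ne_zero.mpr hne
  fin_cases i
  · simp [L.chordA_zero_affine hp hq]
  · have h : (p - q) ^ 3 * W₁ = (p - q) * (p' - q') ^ 2 / 4 - (p + q) * (p - q) ^ 3 := by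
      rw [hW₁]; field_simp; ring
    simpa [L.chordA_one_affine hp hq] using h
  · have h : (p - q) ^ 3 * W₂ =
        -(p' * (p - q) ^ 3) - (p' - q') ^ 3 / 4 + (2 * p + q) * (p' - q') * (p - q) ^ 2 := by
      rw [hW₂, hW₁]; field_simp; ring
    simpa [L.chordA_two_affine hp hq] using h

/-- The polynomial identity behind the `ζ`-companion law: with `E_i = (p-q)³Wᵢ` in polynomial
form and `E₁′ = (p-q)²W₁`, `½(p′-q′)E_i + 2δ_{i2}E₁′² = (p-q)·(2p²·Sx_i - 2q²·Sy_i + C_i)`, where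
`Sx_i = ∑_k α^{(i)}_{2k}(y) x_k`, `Sy_i = ∑_k α^{(i)}_{2k}(x) y_k`. [folklore] -/
theorem _root_.PeriodPair.chord_companion_poly (i : Fin 3)
    (hp : p' ^ 2 = 4 * p ^ 3 - L.g₂ * p - L.g₃) (hq : q' ^ 2 = 4 * q ^ 3 - L.g₂ * q - L.g₃) :
    (p' - q') / 2 * ![(p - q) ^ 3, (p - q) * (p' - q') ^ 2 / 4 - (p + q) * (p - q) ^ 3,
        -(p' * (p - q) ^ 3) - (p' - q') ^ 3 / 4 + (2 * p + q) * (p' - q') * (p - q) ^ 2] i +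
      ![0, 0, 2 * ((p' - q') ^ 2 / 4 - (p + q) * (p - q) ^ 2) ^ 2] i =
    (p - q) * (2 * p ^ 2 * L.chordB i ![1, q, q'] ![0, 0, 1] ![1, p, p'] -
      2 * q ^ 2 * L.chordB i ![1, p, p'] ![0, 0, 1] ![1, q, q'] + L.chordC i ![1, p, p'] ![1, q, q']) := by
  fin_cases i
  · simp [L.chordB_eq, PeriodPair.chordC, PeriodPair.chordCoeff]
    ring
  · simp [L.chordB_eq, PeriodPair.chordC, PeriodPair.chordCoeff]
    linear_combination (p * p' / 8 - p * q' / 4 - p' * q / 8 + q * q' / 4) * hp +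
      (p * p' / 4 - p * q' / 8 - p' * q / 4 + q * q' / 8) * hq
  · simp [L.chordB_eq, PeriodPair.chordC, PeriodPair.chordCoeff]
    linear_combination (-(p ^ 3) / 2 + p ^ 2 * q - p * q ^ 2 / 4 - p * L.g₂ / 16 - q ^ 3 / 4 +
        q * L.g₂ / 16) * hp +
      (-(p ^ 3) / 4 - p ^ 2 * q / 4 + p * q ^ 2 + p * L.g₂ / 16 - q ^ 3 / 2 - q * L.g₂ / 16) * hq

/-- Structure of the companion slot: `B_i(y; ζx + 2p²e₂, x) = ζ A_i(x, y) + 2p² B_i(y; e₂, x)`.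
[folklore] -/
theorem _root_.PeriodPair.chordB_companion (i : Fin 3) (ζ c : ℂ) (y x : Fin 3 → ℂ) :
    L.chordB i y (fun j => ζ * x j + ![(0 : ℂ), 0, c] j) x =
      ζ * L.chordA i x y + c * L.chordB i y ![0, 0, 1] x := by
  rw [L.chordB_eq, L.chordB_eq, L.chordA_eq]
  simp
  ring

/-- **The affine `ζ`-companion identity**: with `W₁ = ℘(z+t)`, `W₂ = ℘′(z+t)` and
`ζ(z+t) = ζ₁ + ζ₂ + ½(p′-q′)/(p-q)`,
`(p-q)³ (ζ(z+t)·(1, W₁, W₂)_i + 2W₁²δ_{i2}) = B_i(y; ẑ, x) - B_i(x; ẑ′, y) + C_i(x, y)` where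
`ẑ = (ζ₁, pζ₁, p′ζ₁ + 2p²)`, `ẑ′ = (ζ₂, qζ₂, q′ζ₂ + 2q²)` are the affine companion vectors. [folklore] -/
theorem _root_.PeriodPair.chord_companion_affine (i : Fin 3)
    (hp : p' ^ 2 = 4 * p ^ 3 - L.g₂ * p - L.g₃) (hq : q' ^ 2 = 4 * q ^ 3 - L.g₂ * q - L.g₃)
    (hne : p ≠ q) {W₁ W₂ : ℂ} (hW₁ : W₁ = ((p' - q') / (p - q)) ^ 2 / 4 - p - q)
    (hW₂ : W₂ = -(p' + (p' - q') / (p - q) * (W₁ - p))) (ζ₁ ζ₂ : ℂ) :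
    (p - q) ^ 3 * ((ζ₁ + ζ₂ + (p' - q') / (p - q) / 2) * ![1, W₁, W₂] i + ![0, 0, 2 * W₁ ^ 2] i) =
      L.chordB i ![1, q, q'] ![ζ₁, p * ζ₁, p' * ζ₁ + 2 * p ^ 2] ![1, p, p'] -
        L.chordB i ![1, p, p'] ![ζ₂, q * ζ₂, q' * ζ₂ + 2 * q ^ 2] ![1, q, q'] +
        L.chordC i ![1, p, p'] ![1, q, q'] := by
  have hD : p - q ≠ 0 := sub_ne_zero.mpr hne
  -- the companion vectors are `ζ x + 2p² e₂`
  have hv₁ : (![ζ₁, p * ζ₁, p' * ζ₁ + 2 * p ^ 2] : Fin 3 → ℂ) =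
      fun j => ζ₁ * ![(1 : ℂ), p, p'] j + ![(0 : ℂ), 0, 2 * p ^ 2] j := by
    funext j; fin_cases j <;> simp <;> ring
  have hv₂ : (![ζ₂, q * ζ₂, q' * ζ₂ + 2 * q ^ 2] : Fin 3 → ℂ) =
      fun j => ζ₂ * ![(1 : ℂ), q, q'] j + ![(0 : ℂ), 0, 2 * q ^ 2] j := by
    funext j; fin_cases j <;> simp <;> ring
  rw [hv₁, hv₂, L.chordB_companion, L.chordB_companion, L.chordA_swap i ![1, p, p'] ![1, q, q'],
    ← L.chordA_affine i hp hq hne hW₁ hW₂]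
  have hpoly := L.chord_companion_poly i hp hq
  fin_cases i
  · simp at hpoly ⊢
    refine mul_left_cancel₀ hD ?_
    have key : (p - q) * ((p - q) ^ 3 * (ζ₁ + ζ₂ + (p' - q') / (p - q) / 2)) =
        (ζ₁ + ζ₂) * (p - q) * (p - q) ^ 3 + (p' - q') / 2 * (p - q) ^ 3 := by
      field_simp
    linear_combination key + hpoly
  · simp at hpoly ⊢
    refine mul_left_cancel₀ hD ?_
    have key : (p - q) * ((p - q) ^ 3 * ((ζ₁ + ζ₂ + (p' - q') / (p - q) / 2) * W₁)) =
        (ζ₁ + ζ₂) * (p - q) * ((p - q) ^ 3 * W₁) +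
          (p' - q') / 2 * ((p - q) * (p' - q') ^ 2 / 4 - (p + q) * (p - q) ^ 3) := by
      rw [hW₁]; field_simp; ring
    linear_combination key + hpoly
  · simp at hpoly ⊢
    refine mul_left_cancel₀ hD ?_
    have key : (p - q) * ((p - q) ^ 3 * ((ζ₁ + ζ₂ + (p' - q') / (p - q) / 2) * W₂ + 2 * W₁ ^ 2)) =
        (ζ₁ + ζ₂) * (p - q) * ((p - q) ^ 3 * W₂) +
          ((p' - q') / 2 * (-(p' * (p - q) ^ 3) - (p' - q') ^ 3 / 4 +
              (2 * p + q) * (p' - q') * (p - q) ^ 2) +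
            2 * ((p' - q') ^ 2 / 4 - (p + q) * (p - q) ^ 2) ^ 2) := by
      rw [hW₂, hW₁]; field_simp; ring
    linear_combination key + hpoly

end Algebra

/-! ### Continuity of the forms -/

/-- The coefficient forms are continuous (polynomials). [folklore] -/
theorem _root_.PeriodPair.continuous_chordCoeff (i j k : Fin 3) :
    Continuous fun y : Fin 3 → ℂ => L.chordCoeff i j k y := by
  fin_cases i <;> fin_cases j <;> fin_cases k <;> simp [PeriodPair.chordCoeff] <;> fun_prop

/-- `B_i` is continuous in all its arguments. [folklore] -/
theorem _root_.PeriodPair.continuous_chordB (i : Fin 3) :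
    Continuous fun v : (Fin 3 → ℂ) × (Fin 3 → ℂ) × (Fin 3 → ℂ) => L.chordB i v.1 v.2.1 v.2.2 := by
  unfold PeriodPair.chordB
  refine continuous_finsetSum _ fun j _ => continuous_finsetSum _ fun k _ => ?_
  exact ((L.continuous_chordCoeff i j k).comp continuous_fst).mul
    (((continuous_apply j).comp (continuous_fst.comp continuous_snd)).mul
      ((continuous_apply k).comp (continuous_snd.comp continuous_snd)))

/-- `A_i` is continuous in both arguments. [folklore] -/
theorem _root_.PeriodPair.continuous_chordA (i : Fin 3) :
    Continuous fun v : (Fin 3 → ℂ) × (Fin 3 → ℂ) => L.chordA i v.1 v.2 := by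
  unfold PeriodPair.chordA
  refine continuous_finsetSum _ fun j _ => continuous_finsetSum _ fun k _ => ?_
  exact ((L.continuous_chordCoeff i j k).comp continuous_snd).mul
    (((continuous_apply j).comp continuous_fst).mul ((continuous_apply k).comp continuous_fst))

/-- `C_i` is continuous in both arguments. [folklore] -/
theorem _root_.PeriodPair.continuous_chordC (i : Fin 3) :
    Continuous fun v : (Fin 3 → ℂ) × (Fin 3 → ℂ) => L.chordC i v.1 v.2 := by
  fin_cases i <;> simp [PeriodPair.chordC] <;> fun_prop

/-- `z ↦ (P₀, P₁, P₂)(z)` is continuous. [folklore] -/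
theorem _root_.PeriodPair.continuous_univExtP_vec :
    Continuous fun z : ℂ => fun j : Fin 3 => L.univExtP j z :=
  continuous_pi fun j => (L.differentiable_univExtP j).continuous

/-- `z ↦ (Z₀, Z₁, Z₂)(z)` is continuous. [folklore] -/
theorem _root_.PeriodPair.continuous_univExtZ_vec :
    Continuous fun z : ℂ => fun j : Fin 3 => L.univExtZ j z :=
  continuous_pi fun j => (L.differentiable_univExtZ j).continuous

/-! ### The blocks as `σ³`-multiples of affine vectors (off the lattice) -/

variable {L} in
/-- Off the lattice `P(z) = σ(z)³ · (1, ℘(z), ℘′(z))`. [folklore] -/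
theorem _root_.PeriodPair.univExtP_vec_eq {z : ℂ} (hz : z ∉ L.lattice) :
    (fun j : Fin 3 => L.univExtP j z) = L.weierstrassSigma z ^ 3 • ![1, ℘[L] z, ℘'[L] z] := by
  obtain ⟨p0, p1, p2⟩ := PeriodPair.univExtP_eq (L := L) hz
  funext j
  fin_cases j
  · simp [p0]
  · simp [p1]
  · simp [p2]

variable {L} in
/-- Off the lattice `Z(z) = σ(z)³ · (ζ, ℘ζ, ℘′ζ + 2℘²)(z)`. [folklore] -/
theorem _root_.PeriodPair.univExtZ_vec_eq {z : ℂ} (hz : z ∉ L.lattice) :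
    (fun j : Fin 3 => L.univExtZ j z) = L.weierstrassSigma z ^ 3 •
      ![L.weierstrassZeta z, ℘[L] z * L.weierstrassZeta z,
        ℘'[L] z * L.weierstrassZeta z + 2 * ℘[L] z ^ 2] := by
  obtain ⟨z0, z1, z2⟩ := PeriodPair.univExtZ_eq (L := L) hz
  funext j
  fin_cases j
  · simp [z0]
  · simp [z1]
  · simp [z2]

variable {L} in
/-- **The `σ`-product formula, cleared of denominators**:
`σ(z - t) σ(z + t) = -(℘(z) - ℘(t)) σ(z)² σ(t)²` for `z, t ∉ Λ`. [cite: ArmitageEberlein2001, §7.4.1 eq. (7.63)] -/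
theorem _root_.PeriodPair.sigma_sub_mul_sigma_add {z t : ℂ} (hz : z ∉ L.lattice) (ht : t ∉ L.lattice) :
    L.weierstrassSigma (z - t) * L.weierstrassSigma (z + t) =
      -(℘[L] z - ℘[L] t) * L.weierstrassSigma z ^ 2 * L.weierstrassSigma t ^ 2 := by
  have h := L.weierstrassP_sub_eq_sigma_holds z t hz ht
  have hσz := L.weierstrassSigma_ne_zero hz
  have hσt := L.weierstrassSigma_ne_zero ht
  rw [h]
  field_simp

/-! ### The chord law for the blocks `P`, off the diagonal -/

variable {L} in
/-- The chord law at a generic pair: `z, t ∉ Λ`, `℘(z) ≠ ℘(t)`. [folklore] -/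
theorem _root_.PeriodPair.chordA_univExtP_of_ne {z t : ℂ} (hz : z ∉ L.lattice) (ht : t ∉ L.lattice)
    (hne : ℘[L] z ≠ ℘[L] t) (i : Fin 3) :
    L.chordA i (fun j => L.univExtP j z) (fun j => L.univExtP j t) =
      -(L.weierstrassSigma (z - t) ^ 3 * L.univExtP i (z + t)) := by
  have hu : z + t ∉ L.lattice := PeriodPair.add_notMem_lattice_of_weierstrassP_ne hne
  have hp := L.derivWeierstrassP_sq z hz
  have hq := L.derivWeierstrassP_sq t ht
  have hadd := L.weierstrassP_add_holds z t hz ht hne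
  have hadd' := L.derivWeierstrassP_add_of_ne hz ht hne
  have h3 : (L.weierstrassSigma (z - t) * L.weierstrassSigma (z + t)) ^ 3 =
      (-(℘[L] z - ℘[L] t) * L.weierstrassSigma z ^ 2 * L.weierstrassSigma t ^ 2) ^ 3 := by
    rw [PeriodPair.sigma_sub_mul_sigma_add hz ht]
  have hPu : L.univExtP i (z + t) =
      L.weierstrassSigma (z + t) ^ 3 * ![1, ℘[L] (z + t), ℘'[L] (z + t)] i := by
    have := congr_fun (PeriodPair.univExtP_vec_eq hu) i
    simpa using this
  rw [PeriodPair.univExtP_vec_eq hz, PeriodPair.univExtP_vec_eq ht, L.chordA_smul_left,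
    L.chordA_smul_right, ← L.chordA_affine i hp hq hne hadd hadd', hPu]
  linear_combination (![1, ℘[L] (z + t), ℘'[L] (z + t)] i) * h3

/-! ### The `ζ`-companion law, off the diagonal -/

variable {L} in
/-- The companion law at a generic pair: `z, t ∉ Λ`, `℘(z) ≠ ℘(t)`. [folklore] -/
theorem _root_.PeriodPair.chord_companion_of_ne {z t : ℂ} (hz : z ∉ L.lattice) (ht : t ∉ L.lattice)
    (hne : ℘[L] z ≠ ℘[L] t) (i : Fin 3) :
    L.chordB i (fun j => L.univExtP j t) (fun j => L.univExtZ j z) (fun j => L.univExtP j z) -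
        L.chordB i (fun j => L.univExtP j z) (fun j => L.univExtZ j t) (fun j => L.univExtP j t) +
        L.chordC i (fun j => L.univExtP j z) (fun j => L.univExtP j t) =
      -(L.weierstrassSigma (z - t) ^ 3 * L.univExtZ i (z + t)) := by
  have hu : z + t ∉ L.lattice := PeriodPair.add_notMem_lattice_of_weierstrassP_ne hne
  have hp := L.derivWeierstrassP_sq z hz
  have hq := L.derivWeierstrassP_sq t ht
  have hadd := L.weierstrassP_add_holds z t hz ht hne
  have hadd' := L.derivWeierstrassP_add_of_ne hz ht hne
  have hζ := L.weierstrassZeta_add_holds z t hz ht hne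
  have h3 : (L.weierstrassSigma (z - t) * L.weierstrassSigma (z + t)) ^ 3 =
      (-(℘[L] z - ℘[L] t) * L.weierstrassSigma z ^ 2 * L.weierstrassSigma t ^ 2) ^ 3 := by
    rw [PeriodPair.sigma_sub_mul_sigma_add hz ht]
  -- the companion block at `z + t`, with `ζ(z+t)` expanded by the addition theorem
  set ζu : ℂ := L.weierstrassZeta z + L.weierstrassZeta t + (℘'[L] z - ℘'[L] t) / (℘[L] z - ℘[L] t) / 2
    with hζu
  have hZu : L.univExtZ i (z + t) = L.weierstrassSigma (z + t) ^ 3 *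
      (ζu * ![1, ℘[L] (z + t), ℘'[L] (z + t)] i + ![0, 0, 2 * ℘[L] (z + t) ^ 2] i) := by
    have := congr_fun (PeriodPair.univExtZ_vec_eq hu) i
    rw [hζ] at this
    fin_cases i
    · simpa using this
    · simp at this ⊢; rw [this]; ring
    · simp at this ⊢; rw [this]; ring
  have haff := L.chord_companion_affine i hp hq hne hadd hadd' (L.weierstrassZeta z)
    (L.weierstrassZeta t)
  rw [PeriodPair.univExtP_vec_eq hz, PeriodPair.univExtP_vec_eq ht, PeriodPair.univExtZ_vec_eq hz,
    PeriodPair.univExtZ_vec_eq ht, L.chordB_smul_left, L.chordB_smul_mid, L.chordB_smul_right,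
    L.chordB_smul_left, L.chordB_smul_mid, L.chordB_smul_right, L.chordC_smul_left,
    L.chordC_smul_right, hZu]
  linear_combination (ζu * ![1, ℘[L] (z + t), ℘'[L] (z + t)] i + ![0, 0, 2 * ℘[L] (z + t) ^ 2] i) * h3 -
    (L.weierstrassSigma z ^ 6 * L.weierstrassSigma t ^ 6) * haff

/-! ### Extension to all pairs `(z, t)` by continuity -/

/-- For fixed `t`, the generic `z` (`z, z + t, z - t ∉ Λ`) are dense (the lattice is countable).
[folklore] -/
theorem _root_.PeriodPair.dense_generic (t : ℂ) :
    Dense {z : ℂ | z ∉ L.lattice ∧ z + t ∉ L.lattice ∧ z - t ∉ L.lattice} := by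
  have hΛ : (L.lattice : Set ℂ).Countable := by
    have : (L.lattice : Set ℂ) ⊆
        Set.range (fun p : ℤ × ℤ => (p.1 : ℂ) * L.ω₁ + (p.2 : ℂ) * L.ω₂) := by
      intro x hx
      obtain ⟨m, n, h⟩ := PeriodPair.mem_lattice.mp hx
      exact ⟨(m, n), h⟩
    exact (Set.countable_range _).mono this
  have hc : ((L.lattice : Set ℂ) ∪ (fun l : ℂ => l - t) '' (L.lattice : Set ℂ) ∪
      (fun l : ℂ => l + t) '' (L.lattice : Set ℂ)).Countable :=
    (hΛ.union (hΛ.image _)).union (hΛ.image _)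
  refine (hc.dense_compl ℂ).mono ?_
  intro z hz
  simp only [Set.mem_compl_iff, Set.mem_union, Set.mem_image, SetLike.mem_coe, not_or,
    not_exists, not_and] at hz
  obtain ⟨⟨h1, h2⟩, h3⟩ := hz
  exact ⟨h1, fun h => h2 (z + t) h (by ring), fun h => h3 (z - t) h (by ring)⟩

/-- The complement of the lattice is dense. [folklore] -/
theorem _root_.PeriodPair.dense_compl_lattice : Dense ((L.lattice : Set ℂ)ᶜ) := by
  refine (L.dense_generic 0).mono ?_
  intro z hz
  exact hz.1

/-- Continuity in `z` of `A_i(P(z), P(t))`. [folklore] -/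
theorem _root_.PeriodPair.continuous_chordA_univExtP (i : Fin 3) (t : ℂ) :
    Continuous fun z : ℂ => L.chordA i (fun j => L.univExtP j z) (fun j => L.univExtP j t) :=
  Continuous.comp (g := fun v : (Fin 3 → ℂ) × (Fin 3 → ℂ) => L.chordA i v.1 v.2)
    (f := fun z : ℂ => ((fun j : Fin 3 => L.univExtP j z), (fun j : Fin 3 => L.univExtP j t)))
    (L.continuous_chordA i) (L.continuous_univExtP_vec.prodMk continuous_const)

/-- Continuity in `z` of the companion expression. [folklore] -/
theorem _root_.PeriodPair.continuous_chord_companion (i : Fin 3) (t : ℂ) :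
    Continuous fun z : ℂ =>
      L.chordB i (fun j => L.univExtP j t) (fun j => L.univExtZ j z) (fun j => L.univExtP j z) -
        L.chordB i (fun j => L.univExtP j z) (fun j => L.univExtZ j t) (fun j => L.univExtP j t) +
        L.chordC i (fun j => L.univExtP j z) (fun j => L.univExtP j t) := by
  have hP := L.continuous_univExtP_vec
  have hZ := L.continuous_univExtZ_vec
  have h₁ : Continuous fun z : ℂ =>
      L.chordB i (fun j => L.univExtP j t) (fun j => L.univExtZ j z) (fun j => L.univExtP j z) :=
    Continuous.comp (g := fun v : (Fin 3 → ℂ) × (Fin 3 → ℂ) × (Fin 3 → ℂ) => L.chordB i v.1 v.2.1 v.2.2)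
      (f := fun z : ℂ => ((fun j : Fin 3 => L.univExtP j t), (fun j : Fin 3 => L.univExtZ j z),
        (fun j : Fin 3 => L.univExtP j z)))
      (L.continuous_chordB i) (continuous_const.prodMk (hZ.prodMk hP))
  have h₂ : Continuous fun z : ℂ =>
      L.chordB i (fun j => L.univExtP j z) (fun j => L.univExtZ j t) (fun j => L.univExtP j t) :=
    Continuous.comp (g := fun v : (Fin 3 → ℂ) × (Fin 3 → ℂ) × (Fin 3 → ℂ) => L.chordB i v.1 v.2.1 v.2.2)
      (f := fun z : ℂ => ((fun j : Fin 3 => L.univExtP j z), (fun j : Fin 3 => L.univExtZ j t),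
        (fun j : Fin 3 => L.univExtP j t)))
      (L.continuous_chordB i) (hP.prodMk (continuous_const.prodMk continuous_const))
  have h₃ : Continuous fun z : ℂ => L.chordC i (fun j => L.univExtP j z) (fun j => L.univExtP j t) :=
    Continuous.comp (g := fun v : (Fin 3 → ℂ) × (Fin 3 → ℂ) => L.chordC i v.1 v.2)
      (f := fun z : ℂ => ((fun j : Fin 3 => L.univExtP j z), (fun j : Fin 3 => L.univExtP j t)))
      (L.continuous_chordC i) (hP.prodMk continuous_const)
  exact (h₁.sub h₂).add h₃

/-- Continuity in `z` of `-σ(z - t)³ P_i(z + t)`. [folklore] -/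
theorem _root_.PeriodPair.continuous_sigma_mul_univExtP (i : Fin 3) (t : ℂ) :
    Continuous fun z : ℂ => -(L.weierstrassSigma (z - t) ^ 3 * L.univExtP i (z + t)) :=
  (((L.differentiable_weierstrassSigma_holds.comp (differentiable_id.sub_const t)).pow 3).mul
    ((L.differentiable_univExtP i).comp (differentiable_id.add_const t))).continuous.neg

/-- Continuity in `z` of `-σ(z - t)³ Z_i(z + t)`. [folklore] -/
theorem _root_.PeriodPair.continuous_sigma_mul_univExtZ (i : Fin 3) (t : ℂ) :
    Continuous fun z : ℂ => -(L.weierstrassSigma (z - t) ^ 3 * L.univExtZ i (z + t)) :=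
  (((L.differentiable_weierstrassSigma_holds.comp (differentiable_id.sub_const t)).pow 3).mul
    ((L.differentiable_univExtZ i).comp (differentiable_id.add_const t))).continuous.neg

variable {L} in
/-- The chord law for `t ∉ Λ` and all `z` (density of the generic `z`). [folklore] -/
theorem _root_.PeriodPair.chordA_univExtP_of_notMem (i : Fin 3) {t : ℂ} (ht : t ∉ L.lattice) (z : ℂ) :
    L.chordA i (fun j => L.univExtP j z) (fun j => L.univExtP j t) =
      -(L.weierstrassSigma (z - t) ^ 3 * L.univExtP i (z + t)) := by
  have heq := Continuous.ext_on (L.dense_generic t) (L.continuous_chordA_univExtP i t)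
    (L.continuous_sigma_mul_univExtP i t) fun z hz => by
      obtain ⟨hz, hzt, hzt'⟩ := hz
      have hne : ℘[L] z ≠ ℘[L] t := fun h =>
        ((L.weierstrassP_eq_weierstrassP_iff hz ht).mp h).elim hzt hzt'
      exact PeriodPair.chordA_univExtP_of_ne hz ht hne i
  exact congr_fun heq z

variable {L} in
/-- The chord law for `z ∉ Λ` and all `t` (antisymmetry of both sides). [folklore] -/
theorem _root_.PeriodPair.chordA_univExtP_of_notMem_left (i : Fin 3) {z : ℂ} (hz : z ∉ L.lattice)
    (t : ℂ) :
    L.chordA i (fun j => L.univExtP j z) (fun j => L.univExtP j t) =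
      -(L.weierstrassSigma (z - t) ^ 3 * L.univExtP i (z + t)) := by
  have h := PeriodPair.chordA_univExtP_of_notMem i hz t
  rw [L.chordA_swap] at h
  have hσ : L.weierstrassSigma (t - z) = -L.weierstrassSigma (z - t) := by
    rw [← L.weierstrassSigma_neg, neg_sub]
  rw [hσ, add_comm t z] at h
  linear_combination -h

/-- **The chord addition law of the Weierstrass cubic in theta coordinates** (Lange–Ruppert: the
basic addition law of bidegree `(2, 2)` on a Weierstrass cubic, valid off the diagonal): for ALL
`z, t ∈ ℂ` and `i = 0, 1, 2`,
`A_i(P(z), P(t)) = -σ(z - t)³ · P_i(z + t)`,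
where `P = (P₀, P₁, P₂) = σ³(1, ℘, ℘′)` are the `E`-blocks of `UnivExtTheta.lean`. The unit
`-σ(z - t)³` vanishes exactly for `z ≡ t (mod Λ)`; in particular the law is regular at the origin
`z ∈ Λ` of `E`. [cite: SilvermanAEC2009, III.2.3 (group law algorithm, the chord x₃ = λ² − x₁ − x₂, y₃ = −(λx₃ + ν))] [cite: LangeRuppert1985, the example of an elliptic curve in Weierstraß normal form (addition laws of bidegree (2,2), the basic one defined off the diagonal)] -/
theorem _root_.PeriodPair.chordA_univExtP (i : Fin 3) (z t : ℂ) :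
    L.chordA i (fun j => L.univExtP j z) (fun j => L.univExtP j t) =
      -(L.weierstrassSigma (z - t) ^ 3 * L.univExtP i (z + t)) := by
  have heq := Continuous.ext_on L.dense_compl_lattice (L.continuous_chordA_univExtP i t)
    (L.continuous_sigma_mul_univExtP i t) fun z hz =>
      PeriodPair.chordA_univExtP_of_notMem_left i hz t
  exact congr_fun heq z

variable {L} in
/-- The companion law for `t ∉ Λ` and all `z`. [folklore] -/
theorem _root_.PeriodPair.chord_companion_of_notMem (i : Fin 3) {t : ℂ} (ht : t ∉ L.lattice) (z : ℂ) :
    L.chordB i (fun j => L.univExtP j t) (fun j => L.univExtZ j z) (fun j => L.univExtP j z) -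
        L.chordB i (fun j => L.univExtP j z) (fun j => L.univExtZ j t) (fun j => L.univExtP j t) +
        L.chordC i (fun j => L.univExtP j z) (fun j => L.univExtP j t) =
      -(L.weierstrassSigma (z - t) ^ 3 * L.univExtZ i (z + t)) := by
  have heq := Continuous.ext_on (L.dense_generic t) (L.continuous_chord_companion i t)
    (L.continuous_sigma_mul_univExtZ i t) fun z hz => by
      obtain ⟨hz, hzt, hzt'⟩ := hz
      have hne : ℘[L] z ≠ ℘[L] t := fun h =>
        ((L.weierstrassP_eq_weierstrassP_iff hz ht).mp h).elim hzt hzt'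
      exact PeriodPair.chord_companion_of_ne hz ht hne i
  exact congr_fun heq z

variable {L} in
/-- The companion law for `z ∉ Λ` and all `t`. [folklore] -/
theorem _root_.PeriodPair.chord_companion_of_notMem_left (i : Fin 3) {z : ℂ} (hz : z ∉ L.lattice)
    (t : ℂ) :
    L.chordB i (fun j => L.univExtP j t) (fun j => L.univExtZ j z) (fun j => L.univExtP j z) -
        L.chordB i (fun j => L.univExtP j z) (fun j => L.univExtZ j t) (fun j => L.univExtP j t) +
        L.chordC i (fun j => L.univExtP j z) (fun j => L.univExtP j t) =
      -(L.weierstrassSigma (z - t) ^ 3 * L.univExtZ i (z + t)) := by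
  have h := PeriodPair.chord_companion_of_notMem i hz t
  rw [L.chordC_swap] at h
  have hσ : L.weierstrassSigma (t - z) = -L.weierstrassSigma (z - t) := by
    rw [← L.weierstrassSigma_neg, neg_sub]
  rw [hσ, add_comm t z] at h
  linear_combination -h

/-- **The `ζ`-companion of the chord law**: for ALL `z, t ∈ ℂ` and `i = 0, 1, 2`,
`B_i(P(t); Z(z), P(z)) - B_i(P(z); Z(t), P(t)) + C_i(P(z), P(t)) = -σ(z - t)³ · Z_i(z + t)`,
where `Z = σ³(ζ, ℘ζ, ℘′ζ + 2℘²)` are the `ζ`-companions of `UnivExtTheta.lean`: the translate of a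
companion is bilinear in (companions, blocks) on each side plus a bihomogeneous `(2, 2)` correction
in the blocks alone — the addition law of the compactified universal vectorial extension `Ē♮` in
the linear system `|3F₀ + D_∞|`, with the same unit `-σ(z - t)³` as the cubic. [folklore] -/
theorem _root_.PeriodPair.chord_companion (i : Fin 3) (z t : ℂ) :
    L.chordB i (fun j => L.univExtP j t) (fun j => L.univExtZ j z) (fun j => L.univExtP j z) -
        L.chordB i (fun j => L.univExtP j z) (fun j => L.univExtZ j t) (fun j => L.univExtP j t) +
        L.chordC i (fun j => L.univExtP j z) (fun j => L.univExtP j t) =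
      -(L.weierstrassSigma (z - t) ^ 3 * L.univExtZ i (z + t)) := by
  have heq := Continuous.ext_on L.dense_compl_lattice (L.continuous_chord_companion i t)
    (L.continuous_sigma_mul_univExtZ i t) fun z hz =>
      PeriodPair.chord_companion_of_notMem_left i hz t
  exact congr_fun heq z

/-! ### The unit, and the law on the diagonal -/

/-- The unit of the chord law vanishes exactly on the diagonal modulo `Λ`:
`σ(z - t)³ ≠ 0 ↔ z - t ∉ Λ`. [folklore] -/
theorem _root_.PeriodPair.sigma_sub_pow_ne_zero_iff (z t : ℂ) :
    L.weierstrassSigma (z - t) ^ 3 ≠ 0 ↔ z - t ∉ L.lattice := by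
  rw [Ne, pow_eq_zero_iff (by norm_num), L.weierstrassSigma_eq_zero_iff_holds]

/-- On the diagonal modulo `Λ` the chord law degenerates: `A_i(P(z), P(t)) = 0` for
`z ≡ t (mod Λ)` (the bad set of the law is exactly the diagonal). [folklore] -/
theorem _root_.PeriodPair.chordA_univExtP_of_sub_mem (i : Fin 3) {z t : ℂ} (h : z - t ∈ L.lattice) :
    L.chordA i (fun j => L.univExtP j z) (fun j => L.univExtP j t) = 0 := by
  rw [L.chordA_univExtP, (L.weierstrassSigma_eq_zero_iff_holds (z - t)).mpr h]
  ring

/-! ### The law for the theta functions of `E♮` -/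

/-- `B_i` is subtractive in the middle slot. [folklore] -/
theorem _root_.PeriodPair.chordB_sub (i : Fin 3) (y v w x : Fin 3 → ℂ) :
    L.chordB i y (v - w) x = L.chordB i y v x - L.chordB i y w x := by
  simp only [PeriodPair.chordB, Pi.sub_apply, ← Finset.sum_sub_distrib]
  refine Finset.sum_congr rfl fun j _ => Finset.sum_congr rfl fun k _ => ?_
  ring

/-- **Addition law of `E♮`, block coordinates**: for `v = (z, s)`, `w = (t, s′)` in
`Lie E♮ = ℂ²`, `A_i(Θ_{inl ·}(v), Θ_{inl ·}(w)) = -σ(z - t)³ Θ_{inl i}(v + w)`. [folklore] -/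
theorem _root_.PeriodPair.chordA_univExtTheta (i : Fin 3) (v w : ℂ × ℂ) :
    L.chordA i (fun j => L.univExtTheta (Sum.inl j) v) (fun j => L.univExtTheta (Sum.inl j) w) =
      -(L.weierstrassSigma (v.1 - w.1) ^ 3 * L.univExtTheta (Sum.inl i) (v + w)) := by
  simpa using L.chordA_univExtP i v.1 w.1

/-- **Addition law of `E♮`, fibre coordinates** (bihomogeneous of bidegree `(2, 2)` in the six
theta functions on each side, linear in the fibre coordinates `Θ_{inr ·}`): for `v = (z, s)`,
`w = (t, s′)`,
`B_i(Θ_{inl}(w); Θ_{inr}(v), Θ_{inl}(v)) - B_i(Θ_{inl}(v); Θ_{inr}(w), Θ_{inl}(w)) - C_i(Θ_{inl}(v), Θ_{inl}(w))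
 = -σ(z - t)³ Θ_{inr i}(v + w)`. [folklore] -/
theorem _root_.PeriodPair.chord_univExtTheta_inr (i : Fin 3) (v w : ℂ × ℂ) :
    L.chordB i (fun j => L.univExtTheta (Sum.inl j) w) (fun j => L.univExtTheta (Sum.inr j) v)
        (fun j => L.univExtTheta (Sum.inl j) v) -
      L.chordB i (fun j => L.univExtTheta (Sum.inl j) v) (fun j => L.univExtTheta (Sum.inr j) w)
        (fun j => L.univExtTheta (Sum.inl j) w) -
      L.chordC i (fun j => L.univExtTheta (Sum.inl j) v) (fun j => L.univExtTheta (Sum.inl j) w) =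
      -(L.weierstrassSigma (v.1 - w.1) ^ 3 * L.univExtTheta (Sum.inr i) (v + w)) := by
  have hA := L.chordA_univExtP i v.1 w.1
  have hZ := L.chord_companion i v.1 w.1
  have hv : (fun j => v.2 * L.univExtP j v.1 - L.univExtZ j v.1) =
      v.2 • (fun j => L.univExtP j v.1) - fun j => L.univExtZ j v.1 := by
    funext j; simp
  have hw : (fun j => w.2 * L.univExtP j w.1 - L.univExtZ j w.1) =
      w.2 • (fun j => L.univExtP j w.1) - fun j => L.univExtZ j w.1 := by
    funext j; simp
  simp only [PeriodPair.univExtTheta_inl, PeriodPair.univExtTheta_inr, Prod.fst_add, Prod.snd_add]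
  rw [hv, hw, L.chordB_sub, L.chordB_sub, L.chordB_smul_mid, L.chordB_smul_mid, L.chordB_self,
    L.chordB_self, L.chordA_swap i (fun j => L.univExtP j v.1)]
  linear_combination (v.2 + w.2) * hA - hZ

end Literature.NumberTheory.Transcendental

end
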